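import Literature.AlgebraicGeometry.Motives.MixedHodgeStructureSocleRadicalDuality
import HarnessLib

/-!
# The socle and radical series of a mixed Hodge structure; Loewy length ≤ number of weights

In the abelian category of mixed Hodge structures (Cattani–El Zein–Griffiths–Lê, *Hodge Theory*, Thm. 3.2.18;
semisimple objects p. 270) every object on a finite-dimensional space has finite length, hence an ascending
**socle series** `0 = soc⁰ ⊆ soc¹ = soc H ⊆ soc² ⊆ ⋯` (`soc^{k+1}/soc^k = soc(H/soc^k)`) and a descending
**radical series** `H = rad⁰ ⊇ rad¹ = rad H ⊇ ⋯` (`rad^{k+1} = rad(rad^k)`). For a graded-polarizable MHS the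
graded pieces `Gr^W_n` are semisimple (Jannsen, LNM 1400, Thm. 7.9 (proof); the tree's
`IsGradedPolarizable.W_le_socle` / `radical_le_W` of `MixedHodgeStructureSocleRadicalDuality`), so both series move
at least one weight step at a time: **`W_{a+k-1} H ⊆ soc^k H`** when `W_{a-1} H = 0` and **`rad^k H ⊆ W_{b-k} H`** when
`W_b H = H`; in particular both series terminate after at most `b - a + 1` steps (the number of weights in `[a, b]`).
Namespace `MixedHodgeStructure`; everything proved, no named facts.

## References

* [CattaniElZeinGriffithsLe2014] E. Cattani et al. (eds.), Hodge Theory (2014), Thm. 3.2.18, Lemma 3.2.20, p. 270.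
* [Jannsen1990MixedMotives] U. Jannsen, Mixed Motives and Algebraic K-Theory, LNM 1400 (1990), Thm. 7.9.
* [Fujiki1980] A. Fujiki, Duality of mixed Hodge structures of algebraic varieties (1980), (1.6.2).
-/

noncomputable section

namespace Literature.AlgebraicGeometry.Motives

namespace MixedHodgeStructure

universe u v

variable {V : Type u} [AddCommGroup V] [Module ℚ V] [FiniteDimensional ℚ V]
variable {V' : Type v} [AddCommGroup V'] [Module ℚ V'] [FiniteDimensional ℚ V']
variable {H : MixedHodgeStructure V} {H' : MixedHodgeStructure V'}

open Module

/-! ### §1 Radicals under isomorphisms -/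

/-- Isomorphisms of MHS identify radicals. [cite: CattaniElZeinGriffithsLe2014, Thm. 3.2.18] -/
theorem map_radical_eq_of_bijective (f : Hom H H') (hf : Function.Bijective f.toLinearMap) :
    (radical H).toSubmodule.map f.toLinearMap = (radical H').toSubmodule := by
  refine le_antisymm (map_radical_le f) fun y hy => ?_
  refine ⟨(f.inverse hf).toLinearMap y, (f.inverse hf).apply_mem_radical hy, ?_⟩
  rw [← LinearMap.comp_apply, ← Hom.comp_toLinearMap, Hom.comp_inverse, Hom.id_toLinearMap, LinearMap.id_apply]

omit [FiniteDimensional ℚ V] in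
/-- `H ↠ H/0` is an isomorphism. [cite: CattaniElZeinGriffithsLe2014, Lemma 3.2.20] -/
theorem SubMixedHodgeStructure.mkQ_bot_bijective (H : MixedHodgeStructure V) :
    Function.Bijective (SubMixedHodgeStructure.bot H).mkQ.toLinearMap :=
  ⟨by rw [← LinearMap.ker_eq_bot]; exact Submodule.ker_mkQ _, Submodule.mkQ_surjective _⟩

omit [FiniteDimensional ℚ V] in
/-- `H ↪ H` (the top sub-MHS) is an isomorphism. [cite: CattaniElZeinGriffithsLe2014, Lemma 3.2.20] -/
theorem SubMixedHodgeStructure.subtype_top_bijective (H : MixedHodgeStructure V) :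
    Function.Bijective (SubMixedHodgeStructure.top H).subtype.toLinearMap :=
  ⟨Submodule.injective_subtype _, fun y => ⟨⟨y, by rw [SubMixedHodgeStructure.top_toSubmodule]; trivial⟩, rfl⟩⟩

/-! ### §2 The socle series -/

section Series

variable (H)

/-- **The socle series** `soc⁰ = 0`, `soc^{k+1} =` preimage in `H` of `soc(H / soc^k)`.
[cite: CattaniElZeinGriffithsLe2014, Thm. 3.2.18 and p. 270] -/
def socleSeries : ℕ → SubMixedHodgeStructure H
  | 0 => SubMixedHodgeStructure.bot H
  | k + 1 => (socle (socleSeries k).quotient).comap (socleSeries k).mkQ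

omit [FiniteDimensional ℚ V] in
/-- `soc⁰ = 0`. [cite: CattaniElZeinGriffithsLe2014, p. 270] -/
@[simp]
theorem socleSeries_zero : socleSeries H 0 = SubMixedHodgeStructure.bot H := rfl

omit [FiniteDimensional ℚ V] in
/-- The recursion. [cite: CattaniElZeinGriffithsLe2014, p. 270] -/
theorem socleSeries_succ (k : ℕ) :
    socleSeries H (k + 1) = (socle (socleSeries H k).quotient).comap (socleSeries H k).mkQ := rfl

omit [FiniteDimensional ℚ V] in
/-- Underlying subspaces of the recursion. [cite: CattaniElZeinGriffithsLe2014, p. 270] -/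
theorem socleSeries_succ_toSubmodule (k : ℕ) : (socleSeries H (k + 1)).toSubmodule =
    (socle (socleSeries H k).quotient).toSubmodule.comap (socleSeries H k).mkQ.toLinearMap := rfl

omit [FiniteDimensional ℚ V] in
/-- `soc^k ⊆ soc^{k+1}`. [cite: CattaniElZeinGriffithsLe2014, p. 270] -/
theorem le_socleSeries_succ (k : ℕ) : (socleSeries H k).toSubmodule ≤ (socleSeries H (k + 1)).toSubmodule := by
  rw [socleSeries_succ_toSubmodule]
  intro x hx
  rw [Submodule.mem_comap]
  have h0 : (socleSeries H k).mkQ.toLinearMap x = 0 := (Submodule.Quotient.mk_eq_zero _).2 hx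
  rw [h0]
  exact Submodule.zero_mem _

omit [FiniteDimensional ℚ V] in
/-- The socle series is ascending. [cite: CattaniElZeinGriffithsLe2014, p. 270] -/
theorem socleSeries_mono : Monotone fun k => (socleSeries H k).toSubmodule :=
  monotone_nat_of_le_succ (le_socleSeries_succ H)

omit [FiniteDimensional ℚ V] in
/-- **`soc^{k+1}/soc^k = soc(H/soc^k)`** (image form). [cite: CattaniElZeinGriffithsLe2014, p. 270] -/
theorem map_socleSeries_succ (k : ℕ) :
    (socleSeries H (k + 1)).toSubmodule.map (socleSeries H k).mkQ.toLinearMap =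
      (socle (socleSeries H k).quotient).toSubmodule := by
  have hs : Function.Surjective (socleSeries H k).mkQ.toLinearMap := Submodule.mkQ_surjective _
  rw [socleSeries_succ_toSubmodule, Submodule.map_comap_eq_of_surjective hs]

/-- **`soc¹ = soc H`.** [cite: CattaniElZeinGriffithsLe2014, p. 270] -/
theorem socleSeries_one : socleSeries H 1 = socle H := by
  refine SubMixedHodgeStructure.ext ?_
  have hk : LinearMap.ker (SubMixedHodgeStructure.bot H).mkQ.toLinearMap = ⊥ := Submodule.ker_mkQ _
  rw [socleSeries_succ_toSubmodule, socleSeries_zero,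
    ← map_socle_eq_of_bijective _ (SubMixedHodgeStructure.mkQ_bot_bijective H), Submodule.comap_map_eq, hk, sup_bot_eq]

/-- `soc H ⊆ soc^{k+1}`. [cite: CattaniElZeinGriffithsLe2014, p. 270] -/
theorem socle_le_socleSeries_succ (k : ℕ) : (socle H).toSubmodule ≤ (socleSeries H (k + 1)).toSubmodule := by
  rw [← socleSeries_one]
  exact socleSeries_mono H (Nat.succ_le_succ (Nat.zero_le k))

/-- If `H/soc^k` is semisimple the series reaches `H` at the next step. [cite: CattaniElZeinGriffithsLe2014, p. 270] -/
theorem socleSeries_succ_eq_top_of_isSemisimple (k : ℕ) (h : (socleSeries H k).quotient.IsSemisimple) :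
    (socleSeries H (k + 1)).toSubmodule = ⊤ := by
  rw [socleSeries_succ_toSubmodule, socle_eq_top_iff.2 h]
  exact Submodule.comap_top _

/-- Conversely, `soc^{k+1} = H` forces `H/soc^k` semisimple. [cite: CattaniElZeinGriffithsLe2014, p. 270] -/
theorem isSemisimple_quotient_of_socleSeries_succ_eq_top (k : ℕ) (h : (socleSeries H (k + 1)).toSubmodule = ⊤) :
    (socleSeries H k).quotient.IsSemisimple := by
  rw [← socle_eq_top_iff, ← map_socleSeries_succ, h, Submodule.map_top]
  exact Submodule.range_mkQ _

omit [FiniteDimensional ℚ V] in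
/-- Once at `H`, the series stays there. [cite: CattaniElZeinGriffithsLe2014, p. 270] -/
theorem socleSeries_eq_top_of_le {k l : ℕ} (hkl : k ≤ l) (hk : (socleSeries H k).toSubmodule = ⊤) :
    (socleSeries H l).toSubmodule = ⊤ :=
  eq_top_iff.2 (by rw [← hk]; exact socleSeries_mono H hkl)

/-- A semisimple `H` has `soc¹ = H`. [cite: CattaniElZeinGriffithsLe2014, p. 270] -/
theorem IsSemisimple.socleSeries_one_eq_top (h : H.IsSemisimple) : (socleSeries H 1).toSubmodule = ⊤ := by
  rw [socleSeries_one]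
  exact socle_eq_top_iff.2 h

/-! ### §3 The radical series -/

/-- **The radical series** `rad⁰ = H`, `rad^{k+1} = rad(rad^k)` (as a sub-MHS of `H`).
[cite: CattaniElZeinGriffithsLe2014, Thm. 3.2.18 and p. 270] -/
def radicalSeries : ℕ → SubMixedHodgeStructure H
  | 0 => SubMixedHodgeStructure.top H
  | k + 1 => (radical (radicalSeries k).toMixedHodgeStructure).map (radicalSeries k).subtype

/-- `rad⁰ = H`. [cite: CattaniElZeinGriffithsLe2014, p. 270] -/
@[simp]
theorem radicalSeries_zero : radicalSeries H 0 = SubMixedHodgeStructure.top H := rfl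

/-- The recursion. [cite: CattaniElZeinGriffithsLe2014, p. 270] -/
theorem radicalSeries_succ (k : ℕ) :
    radicalSeries H (k + 1) = (radical (radicalSeries H k).toMixedHodgeStructure).map (radicalSeries H k).subtype := rfl

/-- Underlying subspaces of the recursion. [cite: CattaniElZeinGriffithsLe2014, p. 270] -/
theorem radicalSeries_succ_toSubmodule (k : ℕ) : (radicalSeries H (k + 1)).toSubmodule =
    (radical (radicalSeries H k).toMixedHodgeStructure).toSubmodule.map (radicalSeries H k).subtype.toLinearMap := rfl

/-- `rad^{k+1} ⊆ rad^k`. [cite: CattaniElZeinGriffithsLe2014, p. 270] -/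
theorem radicalSeries_succ_le (k : ℕ) : (radicalSeries H (k + 1)).toSubmodule ≤ (radicalSeries H k).toSubmodule := by
  rw [radicalSeries_succ_toSubmodule]
  rintro _ ⟨x, -, rfl⟩
  exact x.2

/-- The radical series is descending. [cite: CattaniElZeinGriffithsLe2014, p. 270] -/
theorem radicalSeries_antitone : Antitone fun k => (radicalSeries H k).toSubmodule :=
  antitone_nat_of_succ_le (radicalSeries_succ_le H)

/-- **`rad¹ = rad H`.** [cite: CattaniElZeinGriffithsLe2014, p. 270] -/
theorem radicalSeries_one : radicalSeries H 1 = radical H :=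
  SubMixedHodgeStructure.ext (by
    rw [radicalSeries_succ_toSubmodule, radicalSeries_zero,
      map_radical_eq_of_bijective _ (SubMixedHodgeStructure.subtype_top_bijective H)])

/-- `rad^{k+1} ⊆ rad H`. [cite: CattaniElZeinGriffithsLe2014, p. 270] -/
theorem radicalSeries_succ_le_radical (k : ℕ) : (radicalSeries H (k + 1)).toSubmodule ≤ (radical H).toSubmodule := by
  rw [← radicalSeries_one]
  exact radicalSeries_antitone H (Nat.succ_le_succ (Nat.zero_le k))

/-- If `rad^k` is semisimple the series reaches `0` at the next step. [cite: CattaniElZeinGriffithsLe2014, p. 270] -/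
theorem radicalSeries_succ_eq_bot_of_isSemisimple (k : ℕ)
    (h : (radicalSeries H k).toMixedHodgeStructure.IsSemisimple) : (radicalSeries H (k + 1)).toSubmodule = ⊥ := by
  rw [radicalSeries_succ_toSubmodule, h.radical_eq_bot, SubMixedHodgeStructure.bot_toSubmodule, Submodule.map_bot]

/-- Conversely, `rad^{k+1} = 0` forces `rad^k` semisimple. [cite: CattaniElZeinGriffithsLe2014, p. 270] -/
theorem isSemisimple_of_radicalSeries_succ_eq_bot (k : ℕ) (h : (radicalSeries H (k + 1)).toSubmodule = ⊥) :
    (radicalSeries H k).toMixedHodgeStructure.IsSemisimple := by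
  rw [radicalSeries_succ_toSubmodule] at h
  exact radical_eq_bot_iff.1
    (Submodule.map_injective_of_injective (Submodule.injective_subtype _) (h.trans (Submodule.map_bot _).symm))

/-- Once at `0`, the series stays there. [cite: CattaniElZeinGriffithsLe2014, p. 270] -/
theorem radicalSeries_eq_bot_of_le {k l : ℕ} (hkl : k ≤ l) (hk : (radicalSeries H k).toSubmodule = ⊥) :
    (radicalSeries H l).toSubmodule = ⊥ :=
  eq_bot_iff.2 (by rw [← hk]; exact radicalSeries_antitone H hkl)

/-- A semisimple `H` has `rad¹ = 0`. [cite: CattaniElZeinGriffithsLe2014, p. 270] -/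
theorem IsSemisimple.radicalSeries_one_eq_bot (h : H.IsSemisimple) : (radicalSeries H 1).toSubmodule = ⊥ := by
  rw [radicalSeries_one, h.radical_eq_bot, SubMixedHodgeStructure.bot_toSubmodule]

variable {H}

/-! ### §4 Graded-polarizable MHS: both series advance at least one weight per step -/

/-- **`W_{a+k-1} H ⊆ soc^k H` when `W_{a-1} H = 0`** (graded-polarizable `H`): by induction, `H/soc^k` is
graded-polarizable with `W_{a+k-1} = 0`, so its weight-`(a+k)` step is in its socle.
[cite: Jannsen1990MixedMotives, Thm. 7.9 (proof)] [cite: CattaniElZeinGriffithsLe2014, p. 270] -/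
theorem IsGradedPolarizable.W_le_socleSeries (hp : H.IsGradedPolarizable) {a : ℤ} (ha : H.W (a - 1) = ⊥) (k : ℕ) :
    H.W (a + k - 1) ≤ (socleSeries H k).toSubmodule := by
  induction k with
  | zero => rw [Nat.cast_zero, add_zero, ha]; exact bot_le
  | succ k ih =>
    have hq : (socleSeries H k).quotient.IsGradedPolarizable :=
      hp.of_surjective (socleSeries H k).mkQ (Submodule.mkQ_surjective _)
    have hW : (socleSeries H k).quotient.W (a + k - 1) = ⊥ := by
      rw [SubMixedHodgeStructure.quotient_W]
      exact LinearMap.le_ker_iff_map.1 (by rw [Submodule.ker_mkQ]; exact ih)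
    have hle := hq.W_le_socle (n := a + k) hW
    rw [SubMixedHodgeStructure.quotient_W, Submodule.map_le_iff_le_comap] at hle
    rw [show (a + ((k + 1 : ℕ) : ℤ) - 1 : ℤ) = a + k by push_cast; ring, socleSeries_succ_toSubmodule]
    exact hle

/-- **Loewy length `≤` number of weights**: if `W_{a-1} H = 0` and `W_b H = H` then `soc^k H = H` for
`k ≥ b - a + 1`. [cite: Jannsen1990MixedMotives, Thm. 7.9 (proof)] [cite: CattaniElZeinGriffithsLe2014, p. 270] -/
theorem IsGradedPolarizable.socleSeries_eq_top (hp : H.IsGradedPolarizable) {a b : ℤ} (ha : H.W (a - 1) = ⊥)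
    (hb : H.W b = ⊤) (k : ℕ) (hk : b - a + 1 ≤ k) : (socleSeries H k).toSubmodule = ⊤ := by
  rw [eq_top_iff, ← hb]
  exact (H.monotone_W (show b ≤ a + k - 1 by omega)).trans (hp.W_le_socleSeries ha k)

/-- **`rad^k H ⊆ W_{b-k} H` when `W_b H = H`** (graded-polarizable `H`): by induction, `rad^k` is graded-polarizable
with `W_{b-k} = everything`, so its radical is in `W_{b-k-1}`.
[cite: Jannsen1990MixedMotives, Thm. 7.9 (proof)] [cite: CattaniElZeinGriffithsLe2014, p. 270] -/
theorem IsGradedPolarizable.radicalSeries_le_W (hp : H.IsGradedPolarizable) {b : ℤ} (hb : H.W b = ⊤) (k : ℕ) :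
    (radicalSeries H k).toSubmodule ≤ H.W (b - k) := by
  induction k with
  | zero => rw [Nat.cast_zero, sub_zero, hb]; exact le_top
  | succ k ih =>
    have hR : (radicalSeries H k).toMixedHodgeStructure.IsGradedPolarizable :=
      hp.of_injective (radicalSeries H k).subtype (Submodule.injective_subtype _)
    have hW : (radicalSeries H k).toMixedHodgeStructure.W (b - k) = ⊤ := eq_top_iff.2 fun x _ => ih x.2
    have hle := hR.radical_le_W hW
    rw [show (b - ((k + 1 : ℕ) : ℤ) : ℤ) = b - k - 1 by push_cast; ring, radicalSeries_succ_toSubmodule,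
      Submodule.map_le_iff_le_comap]
    exact hle

/-- **Dually: `rad^k H = 0` for `k ≥ b - a + 1`** when `W_{a-1} H = 0`, `W_b H = H`.
[cite: Jannsen1990MixedMotives, Thm. 7.9 (proof)] [cite: CattaniElZeinGriffithsLe2014, p. 270] -/
theorem IsGradedPolarizable.radicalSeries_eq_bot (hp : H.IsGradedPolarizable) {a b : ℤ} (ha : H.W (a - 1) = ⊥)
    (hb : H.W b = ⊤) (k : ℕ) (hk : b - a + 1 ≤ k) : (radicalSeries H k).toSubmodule = ⊥ := by
  rw [eq_bot_iff, ← ha]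
  exact (hp.radicalSeries_le_W hb k).trans (H.monotone_W (show b - k ≤ a - 1 by omega))

/-- A pure (one-weight) graded-polarizable MHS: `soc¹ = H`, i.e. `H` is semisimple — the case `a = b`.
[cite: Jannsen1990MixedMotives, Thm. 7.9 (proof)] -/
theorem IsGradedPolarizable.socle_eq_top_of_one_weight (hp : H.IsGradedPolarizable) {n : ℤ} (h₁ : H.W (n - 1) = ⊥)
    (h₂ : H.W n = ⊤) : (socle H).toSubmodule = ⊤ := by
  rw [← socleSeries_one]
  exact hp.socleSeries_eq_top h₁ h₂ 1 (by omega)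

/-- Two weights: `soc² = H`. [cite: Jannsen1990MixedMotives, Thm. 7.9 (proof)] -/
theorem IsGradedPolarizable.socleSeries_two_eq_top_of_two_weights (hp : H.IsGradedPolarizable) {n : ℤ}
    (h₁ : H.W (n - 2) = ⊥) (h₂ : H.W n = ⊤) : (socleSeries H 2).toSubmodule = ⊤ :=
  hp.socleSeries_eq_top (a := n - 1) (by rw [show n - 1 - 1 = n - 2 by ring]; exact h₁) h₂ 2 (by omega)

/-! ### §5 Duality: `(soc^k H)^⊥ = rad^k(H^∨)` -/

omit [FiniteDimensional ℚ V] in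
/-- Linear algebra: for `p ⊆ V` and `T ⊆ V/p`, the forms killing the preimage of `T` are the pull-backs of the forms on
`V/p` killing `T`. [cite: Fujiki1980, (1.6.2) b)] -/
theorem dualAnnihilator_comap_mkQ (p : Submodule ℚ V) (T : Submodule ℚ (V ⧸ p)) :
    (T.comap p.mkQ).dualAnnihilator = T.dualAnnihilator.map p.mkQ.dualMap := by
  refine le_antisymm ?_ ?_
  · intro φ hφ
    have hφp : φ ∈ p.dualAnnihilator := by
      refine (Submodule.mem_dualAnnihilator φ).2 fun x hx => (Submodule.mem_dualAnnihilator φ).1 hφ x ?_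
      rw [Submodule.mem_comap, Submodule.mkQ_apply, (Submodule.Quotient.mk_eq_zero _).2 hx]
      exact T.zero_mem
    rw [← Submodule.range_dualMap_mkQ_eq] at hφp
    obtain ⟨ψ, rfl⟩ := hφp
    refine ⟨ψ, (Submodule.mem_dualAnnihilator ψ).2 fun t ht => ?_, rfl⟩
    obtain ⟨x, rfl⟩ := Submodule.mkQ_surjective p t
    exact (Submodule.mem_dualAnnihilator _).1 hφ x ht
  · rintro _ ⟨ψ, hψ, rfl⟩
    exact (Submodule.mem_dualAnnihilator _).2 fun x hx => (Submodule.mem_dualAnnihilator ψ).1 hψ _ hx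

/-- **`(soc^k H)^⊥ = rad^k(H^∨)`**: inductively, `(soc^{k+1})^⊥ = (H ↠ H/soc^k)^t((soc(H/soc^k))^⊥) =
(H ↠ H/soc^k)^t(rad((H/soc^k)^∨))` and `(H/soc^k)^∨ ≅ (soc^k)^⊥ = rad^k(H^∨)`.
[cite: Fujiki1980, (1.6.2) b)] [cite: CattaniElZeinGriffithsLe2014, p. 270] -/
theorem annihilator_socleSeries (k : ℕ) : (socleSeries H k).annihilator = radicalSeries H.dual k := by
  induction k with
  | zero => rw [socleSeries_zero, radicalSeries_zero, SubMixedHodgeStructure.annihilator_bot]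
  | succ k ih =>
    refine SubMixedHodgeStructure.ext ?_
    have hmk : (socleSeries H k).mkQ.toLinearMap = (socleSeries H k).toSubmodule.mkQ := rfl
    rw [SubMixedHodgeStructure.annihilator_toSubmodule, socleSeries_succ_toSubmodule, radicalSeries_succ_toSubmodule,
      ← ih, hmk, dualAnnihilator_comap_mkQ, ← SubMixedHodgeStructure.annihilator_toSubmodule, annihilator_socle, ← hmk,
      ← Hom.transpose_toLinearMap, ← SubMixedHodgeStructure.annihilator_subtype_comp_quotientDualHom, Hom.comp_toLinearMap,
      Submodule.map_comp, map_radical_eq_of_bijective _ (socleSeries H k).quotientDualHom_bijective]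

/-- `rad^k(H^∨)_⊥ = soc^k H`. [cite: Fujiki1980, (1.6.2) b)] [cite: CattaniElZeinGriffithsLe2014, p. 270] -/
theorem coannihilator_radicalSeries_dual (k : ℕ) : (radicalSeries H.dual k).coannihilator = socleSeries H k := by
  rw [← annihilator_socleSeries, SubMixedHodgeStructure.coannihilator_annihilator]

/-- `dim soc^k H + dim rad^k(H^∨) = dim H`. [cite: Fujiki1980, (1.6.2) b)] -/
theorem finrank_socleSeries_add_finrank_radicalSeries_dual (k : ℕ) :
    finrank ℚ (socleSeries H k).toSubmodule + finrank ℚ (radicalSeries H.dual k).toSubmodule = finrank ℚ V := by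
  rw [← annihilator_socleSeries]
  exact SubMixedHodgeStructure.finrank_add_finrank_annihilator _

/-- The two series have the same length: `soc^k H = H ↔ rad^k(H^∨) = 0`. [cite: Fujiki1980, (1.6.2) b)]
[cite: CattaniElZeinGriffithsLe2014, p. 270] -/
theorem socleSeries_eq_top_iff_radicalSeries_dual_eq_bot (k : ℕ) :
    (socleSeries H k).toSubmodule = ⊤ ↔ (radicalSeries H.dual k).toSubmodule = ⊥ := by
  rw [← annihilator_socleSeries, SubMixedHodgeStructure.annihilator_toSubmodule]
  constructor
  · intro h
    rw [h, Submodule.dualAnnihilator_top]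
  · intro h
    have h' := Subspace.finrank_add_finrank_dualAnnihilator_eq (socleSeries H k).toSubmodule
    rw [h, finrank_bot, add_zero] at h'
    exact Submodule.eq_top_of_finrank_eq h'

end Series

end MixedHodgeStructure

end Literature.AlgebraicGeometry.Motives
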